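import Summits.BirchSwinnertonDyer.BirchSwinnertonDyer.Theorems.GenusKolyvaginAtTwoEquivariantKolyvaginExactAtTwoKolyvaginPrimeDictionary
import Summits.BirchSwinnertonDyer.BirchSwinnertonDyer.Theorems.ByReductionTypeAtTwoRankOneAtTwoOffBigImageOddLocalEngineRegularLemma53Rat
import HarnessLib

/-!
# Route `ByReductionTypeAtTwo`, crux `RankOneAtTwoOffBigImageOddLocal` (stmt-BirchSwinnertonDyer-23716), line
# `refined_kolyvagin_tamagawa_shift_at_two`, stub `stub_sigmaShiftPosDisc`: the Kolyvagin-prime dictionary `ℚ ⟷ K` for the STRICT local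
# condition at a **REGULAR** Kolyvagin prime — no sign condition on `Δ`

Lead prover `prover-cruxlead-stmt-BirchSwinnertonDyer-23716-g4` (2026-08-28; `--supports` the crux, closes nothing).  Second regular-engine
CONSUMER in McCallum §5's global argument, after `…EngineRegularLemma53Rat.lean`.  The sibling route's
`GenusExact.SelmerDescent.zsmul_mem_torsionLocalKer_iff_resTorsion` (seat `bsd-line-gk2-p3`) transfers the strict local condition between
`H¹(ℚ_ℓ, E[q])` and `H¹(K_λ, E[q])` at a Gross–Kolyvagin prime — `(c'·x)_ℓ = 0 ⟺ (c'·res x)_λ = 0` — and uses `Δ < 0` + `Frob(ℓ) = Frob(∞)`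
for exactly one thing: a Frobenius `F` at a prime `𝔓 ∣ ℓ` making `E[q]` a REGULAR `ℤ/q[F]`-module (free of rank one on `P, F·P`), which is what
makes `res : H¹(ℚ_ℓ, E[q]) → H¹(K_λ, E[q])` lossless (`Ĥ*(⟨F⟩, E[q]) = 0`; this line's R1 / LKL / `Ĥ⁻¹ = 0`, cards #7–#8).  On the line's cell
`Δ > 0` that structure is supplied NOT by complex conjugation (which fixes `E[2]`) but by the engine's regular Kolyvagin primes.  Here:

* `zsmul_mem_torsionLocalKer_iff_resTorsion_regular` — the dictionary for `E = W/ℚ` of ANY discriminant sign, `q = 2^M`, `K = ℚ(θ)` quadratic,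
  `ℓ` odd, good, of residue degree `2` in `K`, and REGULAR: some arithmetic Frobenius at some `𝔓₀ ∣ ℓ` acts on `E[q]` as an involution moving
  a `2`-torsion point; `x` Selmer at `ℓ`; conclusion verbatim the sibling's;
* `zsmul_mem_torsionLocalKer_iff_resTorsion_of_notMem_regular` — the same without the Selmer hypothesis (`ℓ ∤ c`), as in the sibling file.

Proof = the sibling's, with its Step 2 (`FrobEqFrobInfty.exists_at` + `exists_regular_generator_of_Δ_neg`) replaced by
`Engine.regularFrobAt_transfer` + `Engine.exists_regular_generator_of_smul_twoTorsion_ne`.  THEOREMS ONLY (no definition, no named fact, no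
`sorry`, standard axioms).  BSD is not proved by any of this; the crux is not proved; the stub is not proved.

References: [McCallumLMS1991] §3 (3), §4 Prop. 4.4; [GrossLMS1991] §3 (3.2), §4, Prop. 9.6; [NeukirchANT1999] I §9 (9.4)–(9.6);
[SerreGaloisCohomology1997] I §2.6 (b).
-/

set_option autoImplicit false
set_option linter.dupNamespace false -- tree convention: `Summit.BirchSwinnertonDyer.BirchSwinnertonDyer.Theorems` (summit = sub-problem)

noncomputable section

open scoped Classical Pointwise

namespace Summit.BirchSwinnertonDyer.BirchSwinnertonDyer.Theorems.OffBigImageOddLocalAtTwo.Engine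

open WeierstrassCurve NumberField IsDedekindDomain Field
open Literature.NumberTheory.EllipticCurves Literature.NumberTheory.GaloisRepresentations
open Summit.BirchSwinnertonDyer.BirchSwinnertonDyer.Theorems.GenusExact.FrobeniusCriterion
open Summit.BirchSwinnertonDyer.BirchSwinnertonDyer.Theorems.GenusExact.SelmerDescent

variable (W : WeierstrassCurve ℚ) [W.IsElliptic]
variable {K : Type} [Field K] [NumberField K]

/-- **The Kolyvagin-prime dictionary `ℚ ⟷ K` for the strict local condition, at a REGULAR Kolyvagin prime (any sign of `Δ`).**  Let `E = W/ℚ`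
be elliptic, `q = 2^M` (`M ≥ 1`); `K = ℚ(θ)` quadratic (`[K : ℚ] = 2`, `θ ∉ ℚ`, `θ² = c ∈ ℤ`); `ℓ` an odd prime at the place `v` of good
reduction, of residue degree `2` in `K` (`λ ∣ v` with `f(λ|v) = 2`), such that some arithmetic Frobenius at some `𝔓₀ ∣ ℓ` acts on `E[q]` as an
involution moving a `2`-torsion point (a regular Kolyvagin prime of the line's engine; on `Δ < 0` every Gross–Kolyvagin prime,
`Engine.regularFrob_of_frobEqFrobInfty_of_Δ_neg`).  Let `x ∈ H¹(ℚ, E[q])` satisfy the Selmer condition at `ℓ`.  Then for every `c' ∈ ℤ`: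
**`c'·x ∈ torsionLocalKer_ℓ(E/ℚ) ⟺ c'·res x ∈ torsionLocalKer_λ(E/K)`**.  [cite: GrossLMS1991, §3 (3.2), §4 and Prop. 9.6]
[cite: McCallumLMS1991, §3 (3) and §4 Prop. 4.4] [cite: SerreGaloisCohomology1997, I §2.6 (b)] -/
theorem zsmul_mem_torsionLocalKer_iff_resTorsion_regular {M : ℕ} (hM : 1 ≤ M) {q : ℕ}
    (hq : q = 2 ^ M) {ℓ : ℕ} (hℓ : ℓ.Prime) (hℓ2 : ℓ ≠ 2) {v : HeightOneSpectrum (𝓞 ℚ)}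
    (hℓv : (ℓ : 𝓞 ℚ) ∈ v.asIdeal) (hgood : W.HasGoodReductionAt v)
    (h2K : Module.finrank ℚ K = 2) {θ : K} (hθ : θ ∉ (algebraMap ℚ K).range) {c : ℤ}
    (hc : θ ^ 2 = algebraMap ℚ K c)
    (hreg : ∃ (𝔓₀ : Ideal (absIntegers (𝓞 ℚ) ℚ)) (h : absoluteGaloisGroup ℚ), 𝔓₀ ∈ v.primesAbove ∧
      IsArithFrobAt (𝓞 ℚ) h 𝔓₀ ∧ (∀ X : geomTorsion W (q : ℤ), h • h • X = X) ∧ ∃ u : geomTorsion W 2, h • u ≠ u)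
    (w : HeightOneSpectrum (𝓞 K)) [w.asIdeal.LiesOver v.asIdeal] (hf : w.asIdeal.inertiaDeg (𝓞 ℚ) = 2)
    {x : galH1Torsion W (q : ℤ)} (hxSel : x ∈ selmerLocalKer W (v.adicCompletion ℚ) (q : ℤ))
    (c' : ℤ) :
    c' • x ∈ W.torsionLocalKer (v.adicCompletion ℚ) (q : ℤ) ↔
      c' • resTorsion W K (q : ℤ) x ∈
        (W.baseChange K).torsionLocalKer (w.adicCompletion K) (q : ℤ) := by
  subst hq
  haveI : Algebra.IsAlgebraic ℚ K := Algebra.IsAlgebraic.of_finite ℚ K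
  -- ### Step 0: bookkeeping at `v` and `w`
  have h2v' : ((2 : ℕ) : 𝓞 ℚ) ∉ v.asIdeal := two_notMem_of_odd_prime_mem hℓ hℓ2 hℓv
  have hqv' : ((2 ^ M : ℕ) : 𝓞 ℚ) ∉ v.asIdeal := by
    rw [Nat.cast_pow]
    exact fun h ↦ h2v' (v.isPrime.mem_of_pow_mem M h)
  have hqv : ((((2 ^ M : ℕ) : ℤ)) : 𝓞 ℚ) ∉ v.asIdeal := by rwa [Int.cast_natCast]
  have hq0 : (2 ^ M : ℕ) ≠ 0 := pow_ne_zero M two_ne_zero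
  have hq0Z : ((2 ^ M : ℕ) : ℤ) ≠ 0 := by exact_mod_cast hq0
  have hvbad : v ∉ W.badPlaces (𝓞 ℚ) := fun h ↦ h hgood
  have hwv : w.asIdeal.under (𝓞 ℚ) = v.asIdeal :=
    (Ideal.LiesOver.over (P := w.asIdeal) (p := v.asIdeal)).symm
  have hgoodK : (W.baseChange K).HasGoodReductionAt w :=
    hasGoodReductionAt_baseChange_of_hasGoodReductionAt W K v w hgood
  have hwbad : w ∉ (W.baseChange K).badPlaces (𝓞 K) := fun h ↦ h hgoodK
  have hqw : ((((2 ^ M : ℕ) : ℤ)) : 𝓞 K) ∉ w.asIdeal := intCast_notMem_of_liesOver K v w hqv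
  -- ### Step 1: the primes — `𝔔₀` (chosen for `K_λ`), `𝔓₁ = ι⁻¹𝔔₀`, `𝔓₀` (chosen for `ℚ_ℓ`)
  obtain ⟨𝔐K, h𝔐K⟩ := w.localPrimesAbove_nonempty
  set 𝔔₀ := w.primeBelow (closureEmb (K := K) (w.adicCompletion K)) 𝔐K with h𝔔₀def
  have h𝔔₀ : 𝔔₀ ∈ w.primesAbove := HeightOneSpectrum.primeBelow_mem_primesAbove h𝔐K
  set 𝔓₁ := 𝔔₀.comap (absIntegersMap ℚ K) with h𝔓₁def
  have h𝔓₁ : 𝔓₁ ∈ v.primesAbove := comap_absIntegersMap_mem_primesAbove hwv h𝔔₀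
  obtain ⟨𝔐, h𝔐⟩ := v.localPrimesAbove_nonempty
  set 𝔓₀ := v.primeBelow (closureEmb (K := ℚ) (v.adicCompletion ℚ)) 𝔐 with h𝔓₀def
  have h𝔓₀ : 𝔓₀ ∈ v.primesAbove := HeightOneSpectrum.primeBelow_mem_primesAbove h𝔐
  haveI : 𝔓₀.IsPrime := h𝔓₀.1
  haveI : 𝔓₁.IsPrime := h𝔓₁.1
  -- ### Step 2: a REGULAR Frobenius `F` at `𝔓₁` (transfer from `𝔓₀'`); regular structure
  obtain ⟨𝔓₀', h, h𝔓₀', hh, hhinv, hhmv⟩ := hreg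
  obtain ⟨F, hFrob, hFF, hFmv⟩ := regularFrobAt_transfer W h𝔓₀' hh hhinv hhmv h𝔓₁
  obtain ⟨P, hPM, hgenF, hfreeF⟩ := exists_regular_generator_of_smul_twoTorsion_ne W F hFmv hM
  have hF2fix : F * F ∈ torsionFixing W ((2 ^ M : ℕ) : ℤ) := by
    rw [mem_torsionFixing_iff]
    intro Q
    rw [mul_smul, hFF]
  -- ### Step 3: `F² = res F'` with `F'` an arithmetic Frobenius at `𝔔₀` fixing `E_K[q]`
  obtain ⟨F', hF'⟩ := sq_mem_range_absGaloisRestrict_of_sq_eq h2K hθ hc F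
  have hresF' : absGaloisRestrict ℚ K F' = F * F := hF'
  have hresF'' : resGal (K := ℚ) K F' = F * F := hresF'
  have hFrob' : IsArithFrobAt (𝓞 K) F' 𝔔₀ :=
    isArithFrobAt_of_absGaloisRestrict_eq_pow hwv h𝔔₀ hFrob (by rw [hresF', hf, pow_two])
  have hF'fix : F' ∈ torsionFixing (W.baseChange K) ((2 ^ M : ℕ) : ℤ) := by
    rw [mem_torsionFixing_iff]
    intro Q
    obtain ⟨P₀, rfl⟩ := (torsionBaseChangeMap_bijective K W ((2 ^ M : ℕ) : ℤ)).2 Q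
    rw [← torsionBaseChangeMap_smul, hresF'', mul_smul, hFF]
  -- ### Step 4: the two criteria
  have hIK : 𝔔₀.inertia (absoluteGaloisGroup K) ≤ torsionFixing (W.baseChange K) ((2 ^ M : ℕ) : ℤ) :=
    inertia_le_torsionFixing (W.baseChange K) hwbad hqw _ h𝔐K
  have hopenK := isOpen_torsionFixing (W.baseChange K) hq0Z
  haveI : CharZero (w.adicCompletion K) :=
    charZero_of_injective_algebraMap (algebraMap K (w.adicCompletion K)).injective
  have hsurjK : Function.Surjective
      (torsionPointsMap (W.baseChange K) (w.adicCompletion K) ((2 ^ M : ℕ) : ℤ)) :=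
    (torsionPointsMap_bijective (W.baseChange K) (w.adicCompletion K) hq0).2
  have hySel : resTorsion W K ((2 ^ M : ℕ) : ℤ) x ∈
      selmerLocalKer (W.baseChange K) (w.adicCompletion K) ((2 ^ M : ℕ) : ℤ) :=
    resTorsion_mem_selmerLocalKer W K v w _ hgood hqv hxSel
  have hyunr : c' • resTorsion W K ((2 ^ M : ℕ) : ℤ) x ∈
      unramifiedKer (geomTorsion (W.baseChange K) ((2 ^ M : ℕ) : ℤ)) 𝔔₀ := by
    rw [← (W.baseChange K).selmerLocalKer_eq_unramifiedKer hgoodK hqw h𝔔₀]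
    exact AddSubgroup.zsmul_mem _ hySel c'
  have hKcrit := mem_torsionLocalKer_iff_h1Eval_eq_zero (W.baseChange K) ((2 ^ M : ℕ) : ℤ) h𝔐K
    hFrob' hF'fix hIK hopenK hsurjK hyunr
  -- (ℚ side) at `𝔓₀ = g • 𝔓₁` with the Frobenius `g F g⁻¹`
  obtain ⟨g, hg⟩ := HeightOneSpectrum.exists_smul_eq_of_mem_primesAbove_holds h𝔓₁ h𝔓₀
  have hFrob₀ : IsArithFrobAt (𝓞 ℚ) (g * F * g⁻¹) 𝔓₀ := hg ▸ hFrob.conj g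
  obtain ⟨hFF₀, hPM₀, hgen₀, hfree₀⟩ := exists_regular_generator_conj W hFF hPM hgenF hfreeF g
  have hIQ : 𝔓₀.inertia (absoluteGaloisGroup ℚ) ≤ torsionFixing W ((2 ^ M : ℕ) : ℤ) :=
    inertia_le_torsionFixing W hvbad hqv _ h𝔐
  have hopenQ := isOpen_torsionFixing W hq0Z
  have hxunr : x ∈ unramifiedKer (geomTorsion W ((2 ^ M : ℕ) : ℤ)) 𝔓₀ := by
    rw [← W.selmerLocalKer_eq_unramifiedKer hgood hqv h𝔓₀]; exact hxSel
  haveI : CharZero (v.adicCompletion ℚ) :=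
    charZero_of_injective_algebraMap (algebraMap ℚ (v.adicCompletion ℚ)).injective
  have hsurjQ : Function.Surjective (@torsionPointsMap ℚ _ W (v.adicCompletion ℚ) _
      (HeightOneSpectrum.instAlgebraAdicCompletion (𝓞 ℚ) ℚ v) ((2 ^ M : ℕ) : ℤ)) :=
    (@torsionPointsMap_bijective ℚ _ _ W _ (v.adicCompletion ℚ) _
      (HeightOneSpectrum.instAlgebraAdicCompletion (𝓞 ℚ) ℚ v) _ (2 ^ M) hq0).2
  have hQcrit := zsmul_mem_torsionLocalKer_iff_norm W h𝔐 hFrob₀ hIQ hopenQ hsurjQ hFF₀ hPM₀ hgen₀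
    hfree₀ hxunr c'
  -- ### Step 5: the link `[x, gF²g⁻¹] = g·[x, F²]`, `[res x, F'] = θ[x, F²]`
  have hnorm : h1Eval W ((2 ^ M : ℕ) : ℤ) x (g * F * g⁻¹) +
      (g * F * g⁻¹) • h1Eval W ((2 ^ M : ℕ) : ℤ) x (g * F * g⁻¹) =
        g • h1Eval W ((2 ^ M : ℕ) : ℤ) x (F * F) := by
    rw [← h1Eval_mul_smul, show g * F * g⁻¹ * (g * F * g⁻¹) = g * (F * F) * g⁻¹ by group,
      h1Eval_conj W ((2 ^ M : ℕ) : ℤ) x g hF2fix]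
  have hθeval : h1Eval (W.baseChange K) ((2 ^ M : ℕ) : ℤ) (c' • resTorsion W K ((2 ^ M : ℕ) : ℤ) x) F' =
      torsionBaseChangeMap W K ((2 ^ M : ℕ) : ℤ) (c' • h1Eval W ((2 ^ M : ℕ) : ℤ) x (F * F)) := by
    rw [h1Eval_zsmul _ _ _ _ hF'fix, h1Eval_resTorsion_eq W K _ x hF'fix, hresF'', map_zsmul]
  rw [hQcrit, hKcrit, hnorm, hθeval, smul_comm c' g, smul_eq_zero_iff_eq,
    map_eq_zero_iff _ (torsionBaseChangeMap_injective W K _)]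

/-- **The regular dictionary WITHOUT the Selmer hypothesis** (`ℓ ∤ c` explicit): for EVERY `x ∈ H¹(ℚ, E[q])` and `c'`,
`c'·x ∈ torsionLocalKer_ℓ ⟺ c'·res x ∈ torsionLocalKer_λ` — both sides force `c'·x` Selmer at `ℓ`, exactly as in the sibling's
`zsmul_mem_torsionLocalKer_iff_resTorsion_of_notMem`. [cite: McCallumLMS1991, §4 Prop. 4.4] [cite: GrossLMS1991, Prop. 9.6] -/
theorem zsmul_mem_torsionLocalKer_iff_resTorsion_of_notMem_regular {M : ℕ} (hM : 1 ≤ M) {q : ℕ}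
    (hq : q = 2 ^ M) {ℓ : ℕ} (hℓ : ℓ.Prime) (hℓ2 : ℓ ≠ 2) {v : HeightOneSpectrum (𝓞 ℚ)}
    (hℓv : (ℓ : 𝓞 ℚ) ∈ v.asIdeal) (hgood : W.HasGoodReductionAt v)
    (h2K : Module.finrank ℚ K = 2) {θ : K} (hθ : θ ∉ (algebraMap ℚ K).range) {c : ℤ}
    (hc : θ ^ 2 = algebraMap ℚ K c) (hcv : ((c : ℤ) : 𝓞 ℚ) ∉ v.asIdeal)
    (hreg : ∃ (𝔓₀ : Ideal (absIntegers (𝓞 ℚ) ℚ)) (h : absoluteGaloisGroup ℚ), 𝔓₀ ∈ v.primesAbove ∧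
      IsArithFrobAt (𝓞 ℚ) h 𝔓₀ ∧ (∀ X : geomTorsion W (q : ℤ), h • h • X = X) ∧ ∃ u : geomTorsion W 2, h • u ≠ u)
    (w : HeightOneSpectrum (𝓞 K)) [w.asIdeal.LiesOver v.asIdeal] (hf : w.asIdeal.inertiaDeg (𝓞 ℚ) = 2)
    (x : galH1Torsion W (q : ℤ)) (c' : ℤ) :
    c' • x ∈ W.torsionLocalKer (v.adicCompletion ℚ) (q : ℤ) ↔
      c' • resTorsion W K (q : ℤ) x ∈
        (W.baseChange K).torsionLocalKer (w.adicCompletion K) (q : ℤ) := by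
  have h2v' : ((2 : ℕ) : 𝓞 ℚ) ∉ v.asIdeal := two_notMem_of_odd_prime_mem hℓ hℓ2 hℓv
  have hqv : ((q : ℤ) : 𝓞 ℚ) ∉ v.asIdeal := by
    rw [Int.cast_natCast, hq, Nat.cast_pow]; exact fun h ↦ h2v' (v.isPrime.mem_of_pow_mem M h)
  have key : c' • x ∈ selmerLocalKer W (v.adicCompletion ℚ) (q : ℤ) →
      (c' • x ∈ W.torsionLocalKer (v.adicCompletion ℚ) (q : ℤ) ↔
        c' • resTorsion W K (q : ℤ) x ∈
          (W.baseChange K).torsionLocalKer (w.adicCompletion K) (q : ℤ)) := fun hsel ↦ by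
    have h := zsmul_mem_torsionLocalKer_iff_resTorsion_regular W hM hq hℓ hℓ2 hℓv hgood h2K hθ hc hreg w hf
      hsel 1
    rwa [one_zsmul, map_zsmul, one_zsmul] at h
  refine ⟨fun h ↦ (key (W.torsionLocalKer_le_selmerLocalKer _ _ h)).mp h, fun h ↦ (key ?_).mpr h⟩
  refine mem_selmerLocalKer_of_resTorsion_mem_quadratic W h2K hθ hc (q : ℤ) v w hgood hqv
    (by exact_mod_cast h2v') hcv ?_
  rw [map_zsmul]
  exact (W.baseChange K).torsionLocalKer_le_selmerLocalKer _ _ h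

end Summit.BirchSwinnertonDyer.BirchSwinnertonDyer.Theorems.OffBigImageOddLocalAtTwo.Engine

end
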